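import Summits.CriticalPhenomena.SAWScalingLimit.Theorems.SAWLoopFugacityFlowAvoidanceLimitFreeBoxGreen
import Literature.Probability.LatticeModels.KilledWalkHubFactorisation
import HarnessLib

/-!
# Hub Green bounds for the edge-killed walk (line `symplectic-fermion-anchor`,
crux `SAWLoopFugacityFlow.AvoidanceLimit`, stmt-CriticalPhenomena-10649; stubs
`killedRegionGreen_le_mul_hitProb_of_boundary`, `killedRegionGreen_mW_le_of_supDist`,
`killedRegionGreen_le_free_add`)

Three Green-function estimates feeding the hub constant `M_B` of Chelkak's factorisation
`P_Λ(u,x) ≍ hitProb_B(u) · max_B P_Λ(·,x)` of the exit kernel of the edge-killed walk (the walk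
on `ℤ²` along the edges of a subgraph `Gr ≤ zdGraph 2`, killed at its first non-`Gr` step;
`killedRegionGreen Gr Λ` is the Green function of the finite region `Λ`,
`hitProb Gr Λ B = killedHarmExt Gr (Λ ∖ B) 𝟙_B`), Chelkak 2016, Proposition 3.1 / Lemma 2.11:

* `killedRegionGreen_le_mul_hitProb_of_boundary` — `G_Λ(m,c) ≤ M · hitProb_B(m)` off `B`, as
  soon as `G_Λ(·,c) ≤ M` on the sites of `B` in the outer boundary of `Λ ∖ B` for the killed walk
  (comparison principle on `Λ ∖ B`; only the boundary layer of the hub is compared, since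
  `G_Λ(c,c) ∼ log` is unbounded);
* `killedRegionGreen_mW_le_of_supDist` — for the free walk in the box `mW c k` (sup-radius `48k`),
  `G(w,c) ≤ C₂` at sup-distance `≥ k` from the pole, uniformly in `c` and `k ≥ 1` (Chelkak 2016,
  Lemma 2.11 with ratio `48`: `G = 2(h - a(· - c))`, `h ≤ max` of the potential kernel over the
  outer layer, and `a(x) = (1/π) log |x| + k₀/2 + O(1/|x|)`);
* `killedRegionGreen_le_free_add` — `G^{Gr}_Λ(·,c) ≤ G^{ℤ²}_W(·,c) + M` whenever `G^{Gr}_Λ(·,c) ≤ M`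
  on `Λ ∖ W`: the difference is subharmonic for the free walk on `Λ ∩ W`, the pole included
  (both Green functions carry the unit source at `c`, and fewer edges give a smaller average of a
  nonnegative function), and is `≤ M` on the outer boundary; maximum principle.

Everything is proved from `KilledWalkLaplacian.lean`, `KilledWalkGreen.lean`,
`KilledWalkHubFactorisation.lean` and the free box Green machinery of
`SAWLoopFugacityFlowAvoidanceLimitFreeBoxGreen.lean`. No definitions.
Sources: D. Chelkak, *Robust discrete complex analysis: a toolbox*, Ann. Probab. 44 (2016),
Lemma 2.11, Proposition 3.1 [Chelkak2016]; G. F. Lawler, *Intersections of Random Walks* (1991),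
Prop. 1.6.7 [Lawler1991].
-/

noncomputable section

open scoped BigOperators Classical
open Finset
open Literature.Probability.LatticeModels
open Literature.Probability.LatticeModels.WeakBeurling (sqBox sqBox_mono mem_sqBox)

namespace Summit.CriticalPhenomena.SAWScalingLimit.Theorems.AvoidanceLimit.Anchor

/-! ### The hub bound through the boundary layer -/

/-- **Green-function upper bound by hitting probabilities, boundary-layer form.** For the
edge-killed walk `Gr` in the finite region `Λ`, a set `B ⊆ Λ`, a pole `c ∈ B` and `0 ≤ M`: if
`G_Λ(w,c) ≤ M` for every `w ∈ B` lying in the outer boundary of `Λ ∖ B` for the killed walk, then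
`G_Λ(m,c) ≤ M · hitProb Gr Λ B m` for every `m ∉ B` — on `Λ ∖ B` by the comparison principle
(`G_Λ(·,c)` is killed-harmonic on `Λ ∖ B ⊆ Λ ∖ {c}`, `M · hitProb_B` is killed-harmonic on `Λ ∖ B`,
and on the outer boundary of `Λ ∖ B` the inequality holds: at the sites of `B` it is the
hypothesis since `hitProb_B = 1` there, and off `Λ` the left side vanishes while `hitProb_B ≥ 0`);
off `Λ` the left side is `0`. This is the hub-term bound `hitProb_{B}(u) ≥ G(u,c) / M_B` with
`M_B` the maximum of the Green column over the boundary layer of the hub.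
[cite: Chelkak2016, Proposition 3.1] -/
theorem killedRegionGreen_le_mul_hitProb_of_boundary :
    ∀ (Gr : SimpleGraph (Site 2)) (Λ B : Set (Site 2)), Λ.Finite → B ⊆ Λ → ∀ (c : Site 2), c ∈ B →
      ∀ (M : ℝ), 0 ≤ M →
      (∀ w ∈ B, w ∈ killedOuterBoundary Gr (Λ \ B) → killedRegionGreen Gr Λ w c ≤ M) →
      ∀ m : Site 2, m ∉ B → killedRegionGreen Gr Λ m c ≤ M * hitProb Gr Λ B m := by
  intro Gr Λ B hΛ _ c hc M hM0 hM m hmB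
  have hSfin : (Λ \ B).Finite := hΛ.subset fun _ hz => hz.1
  -- on the outer boundary of `Λ ∖ B`: in `B` the hypothesis (`hitProb = 1`), off `Λ` the left
  -- side is `0`
  have hbd : ∀ z ∈ killedOuterBoundary Gr (Λ \ B),
      killedRegionGreen Gr Λ z c ≤ M * hitProb Gr Λ B z := by
    intro z hz
    by_cases hzB : z ∈ B
    · rw [hitProb_of_mem hzB, mul_one]; exact hM z hzB hz
    · have hzΛ : z ∉ Λ := fun h => hz.1 ⟨h, hzB⟩
      rw [killedRegionGreen_of_not_mem_left Λ hzΛ c]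
      exact mul_nonneg hM0 (hitProb_nonneg hΛ z)
  by_cases hm : m ∈ Λ \ B
  · -- `G_Λ(·,c)` is killed-harmonic on `Λ ∖ {c} ⊇ Λ ∖ B` (as `c ∈ B`)
    have h1 : IsKilledHarmonicOn Gr (fun z => killedRegionGreen Gr Λ z c) (Λ \ B) :=
      (killedRegionGreen_harmonicOn hΛ c).mono fun z hz =>
        ⟨hz.1, fun h => hz.2 (by rw [Set.mem_singleton_iff.1 h]; exact hc)⟩
    -- `M · hitProb_B` is killed-harmonic on `Λ ∖ B`
    have h2 : IsKilledHarmonicOn Gr (fun z => M * hitProb Gr Λ B z) (Λ \ B) :=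
      (hitProb_harmonicOn hΛ).const_mul M
    exact le_of_killedSub_killedSuper_of_boundary hSfin h1.subharmonicOn h2.superharmonicOn
      hbd m hm
  · have hmΛ : m ∉ Λ := fun h => hm ⟨h, hmB⟩
    rw [killedRegionGreen_of_not_mem_left Λ hmΛ c]
    exact mul_nonneg hM0 (hitProb_nonneg hΛ m)

/-! ### The free box Green function at sup-distance `≥ k` from the pole -/

/-- **Green's function of the free walk in a box is bounded at sup-distance `≥ k` from the
pole** (Chelkak 2016, Lemma 2.11, `G_{B_Γ(r)}(v;u) ≤ const` at distance comparable to `r`, here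
with the ratio `48`; Lawler 1991, Prop. 1.6.7): there is a universal `C₂` with
`killedRegionGreen (zdGraph 2) (mW c k) w c ≤ C₂` for every centre `c`, every `k ≥ 1` and every `w`
outside `sqBox c (k - 1)`. Indeed `G = 2(h - a(· - c))` on the box, `h ≤ (1/π) log (2(48k+1)) +
k₀/2 + O(1/k)` (maximum of the potential kernel over the outer layer) and
`a(w - c) ≥ (1/π) log k + k₀/2 - O(1/k)` for `|w - c| ≥ k`, and `2(48k+1)/k ≤ 98`; off the box
`G = 0`. [cite: Chelkak2016, Lemma 2.11] -/
theorem killedRegionGreen_mW_le_of_supDist :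
    ∃ C₂ : ℝ, ∀ (c : Site 2) (k : ℕ), 0 < k →
      ∀ w : Site 2, w ∉ WeakBeurling.sqBox c ((k : ℤ) - 1) →
        killedRegionGreen (zdGraph 2) (mW c k) w c ≤ C₂ := by
  obtain ⟨C₀, hC₀⟩ := latticePotentialKernel_two_rate
  have hlog98 : 0 ≤ Real.log 98 := Real.log_nonneg (by norm_num)
  refine ⟨2 / Real.pi * Real.log 98 + 4 * |C₀|, fun c k hk w hw => ?_⟩
  by_cases hwW : w ∈ mW c k
  swap
  · rw [killedRegionGreen_of_not_mem_left _ hwW]; positivity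
  have hW := mW_finite c k
  have hk1 : (1 : ℝ) ≤ k := by exact_mod_cast hk
  rw [killedRegionGreen_eq_two_mul_sub hW (centre_mem_mW c k) hwW]
  -- the harmonic extension is at most the maximum of `a(· - c)` over the outer layer
  have hHE : killedHarmExt (zdGraph 2) (mW c k) (fun x => latticePotentialKernel 2 (x - c)) w ≤
      1 / Real.pi * Real.log (2 * (48 * k + 1)) + KozdronLawler.greenConst / 2 +
        |C₀| / (48 * k + 1) := by
    refine killedHarmExt_zdGraph_le hW (fun z hz => ?_) w hwW
    rw [mW_eq_sqBox] at hz
    obtain ⟨hz1, hz2⟩ := mem_layer_of_mem_killedOuterBoundary_sqBox hz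
    have hr : (48 * k + 1 : ℝ) ≤ ‖Site.toComplex (z - c)‖ := by
      have := le_norm_toComplex_of_not_mem_sqBox hz2; push_cast at this; linarith
    have hR : ‖Site.toComplex (z - c)‖ ≤ 2 * (48 * k + 1) := by
      have := norm_toComplex_le_of_mem_sqBox hz1; push_cast at this; linarith
    exact (KozdronLawler.potentialKernel_mem_of_annulus (by linarith) hC₀ hr hR).2
  -- the pole term is at least `(1/π) log k + k₀/2 - |C₀|/k`
  have hρ : (k : ℝ) ≤ ‖Site.toComplex (w - c)‖ := by
    have := le_norm_toComplex_of_not_mem_sqBox hw; push_cast at this; linarith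
  have haw := (KozdronLawler.potentialKernel_mem_of_annulus (r := k) hk1 hC₀ hρ le_rfl).1
  -- logarithms of bounded ratio and the error terms
  have hlog : Real.log (2 * (48 * k + 1)) ≤ Real.log 98 + Real.log k := by
    rw [← Real.log_mul (by norm_num) (by linarith)]
    exact Real.log_le_log (by positivity) (by linarith)
  have hπ : (0 : ℝ) ≤ 1 / Real.pi := by positivity
  have hlog' : 1 / Real.pi * Real.log (2 * (48 * k + 1)) ≤
      1 / Real.pi * Real.log 98 + 1 / Real.pi * Real.log k := by
    rw [← mul_add]; exact mul_le_mul_of_nonneg_left hlog hπ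
  have he1 : |C₀| / (48 * k + 1) ≤ |C₀| := div_le_self (abs_nonneg _) (by linarith)
  have he2 : |C₀| / k ≤ |C₀| := div_le_self (abs_nonneg _) hk1
  have h2π : 2 / Real.pi * Real.log 98 = 2 * (1 / Real.pi * Real.log 98) := by ring
  linarith

/-! ### Comparison with the free Green function of a finite set -/

/-- **The killed Green column is at most a free Green column plus its maximum off the set.**
For `Gr ≤ zdGraph 2`, finite `Λ` and `W`, a pole `c` and `0 ≤ M`: if `G^{Gr}_Λ(w,c) ≤ M` for all
`w ∈ Λ ∖ W`, then `G^{Gr}_Λ(w,c) ≤ G^{ℤ²}_W(w,c) + M` for every `w`. The difference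
`F = G^{Gr}_Λ(·,c) - G^{ℤ²}_W(·,c)` is subharmonic for the free walk on `Λ ∩ W`, the pole included:
`G^{Gr}_Λ = killedAvg_{Gr} G^{Gr}_Λ + 𝟙_c ≤ killedAvg_{ℤ²} G^{Gr}_Λ + 𝟙_c` (fewer edges give a
smaller average of a nonnegative function) and `G^{ℤ²}_W = killedAvg_{ℤ²} G^{ℤ²}_W + 𝟙_c` on `W`;
on the outer boundary of `Λ ∩ W` one has `F ≤ M` (off `Λ` the first term vanishes, on `Λ ∖ W`
the hypothesis, and `G^{ℤ²}_W ≥ 0`), so the maximum principle gives `F ≤ M` on `Λ ∩ W`; if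
`c ∉ Λ` everything vanishes. [folklore] -/
theorem killedRegionGreen_le_free_add :
    ∀ (Gr : SimpleGraph (Site 2)), Gr ≤ zdGraph 2 → ∀ (Λ W : Set (Site 2)), Λ.Finite → W.Finite →
      ∀ (c : Site 2) (M : ℝ), 0 ≤ M →
      (∀ w ∈ Λ, w ∉ W → killedRegionGreen Gr Λ w c ≤ M) →
      ∀ w : Site 2, killedRegionGreen Gr Λ w c ≤ killedRegionGreen (zdGraph 2) W w c + M := by
  intro Gr hGr Λ W hΛ hW c M hM0 hM w
  have hnn : ∀ z, 0 ≤ killedRegionGreen (zdGraph 2) W z c := fun z =>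
    killedRegionGreen_nonneg W z c
  -- the pole outside `Λ`: the left side vanishes
  by_cases hc : c ∈ Λ
  swap
  · rw [killedRegionGreen_of_not_mem_right Λ w hc]; linarith [hnn w]
  -- off `Λ ∩ W` the bound holds pointwise
  have hoff : ∀ z, z ∉ Λ ∩ W →
      killedRegionGreen Gr Λ z c ≤ killedRegionGreen (zdGraph 2) W z c + M := by
    intro z hz
    by_cases hzΛ : z ∈ Λ
    · linarith [hM z hzΛ (fun h => hz ⟨hzΛ, h⟩), hnn z]
    · rw [killedRegionGreen_of_not_mem_left Λ hzΛ c]; linarith [hnn z]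
  by_cases hw : w ∈ Λ ∩ W
  swap
  · exact hoff w hw
  -- the difference is subharmonic for the free walk on `Λ ∩ W`, the pole included
  have hsub : IsKilledSubharmonicOn (zdGraph 2)
      ((fun z => killedRegionGreen Gr Λ z c) - fun z => killedRegionGreen (zdGraph 2) W z c)
      (Λ ∩ W) := by
    intro v hv
    rw [killedAvg_sub, Pi.sub_apply]
    have h1 := killedAvg_killedRegionGreen_sub (Gr := Gr) hΛ hc v hv.1
    have h2 : killedAvg Gr (fun z => killedRegionGreen Gr Λ z c) v ≤
        killedAvg (zdGraph 2) (fun z => killedRegionGreen Gr Λ z c) v :=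
      killedAvg_mono_graph hGr (fun z => killedRegionGreen_nonneg Λ z c) v
    have h3 : killedAvg (zdGraph 2) (fun z => killedRegionGreen (zdGraph 2) W z c) v +
          (if v = c then 1 else 0) ≤ killedRegionGreen (zdGraph 2) W v c := by
      by_cases hcW : c ∈ W
      · have := killedAvg_killedRegionGreen_sub (Gr := zdGraph 2) hW hcW v hv.2
        linarith
      · -- the pole is outside `W`: the free Green column vanishes and `v ≠ c`
        have hvc : v ≠ c := fun h => hcW (h ▸ hv.2)
        simp only [if_neg hvc, add_zero, killedRegionGreen_of_not_mem_right W _ hcW,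
          killedAvg_zero, le_refl]
    split_ifs at h1 h3 <;> linarith
  have key := hsub.le_of_forall_boundary_le (hΛ.subset fun _ hz => hz.1) hM0
    (fun z hz => by
      rw [Pi.sub_apply, sub_le_iff_le_add']
      exact hoff z hz.1) w hw
  rwa [Pi.sub_apply, sub_le_iff_le_add'] at key

end Summit.CriticalPhenomena.SAWScalingLimit.Theorems.AvoidanceLimit.Anchor

end
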